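import Literature.Computability.Complexity.KarpProblems
import Literature.Combinatorics.SimpleGraph.HamiltonianCycleListings
import Literature.Computability.Complexity.IndexAllBricks
import Literature.Computability.Complexity.ListFoldBricks
import Literature.Computability.Complexity.IsqrtBrick
import Literature.Computability.Complexity.FPStringBricks
import Literature.Computability.Complexity.PlumbingBricks
import Literature.Computability.Complexity.ReductionsProofs
import HarnessLib

/-!
# Karp's problem 9, DIRECTED HAMILTON CIRCUIT, and `DIRECTED HAMILTON CIRCUIT ∝ HAMILTON CIRCUIT`

Companion of `KarpProblems.lean` (Karp 1972, Main Theorem; that file vendors problems 3, 10, 12,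
17, 18, 20, 21 as languages over `{0,1}`). Karp's NP-completeness proof for problem 10, UNDIRECTED
HAMILTON CIRCUIT, goes through problem 9:

  "DIRECTED HAMILTON CIRCUIT. INPUT: digraph `H`. PROPERTY: `H` has a directed cycle which
  includes each node exactly once."  (Karp 1972, §4, Main Theorem, problem 9)

with the chain `SATISFIABILITY ∝ … ∝ DIRECTED HAMILTON CIRCUIT ∝ HAMILTON CIRCUIT`.

## Part 1. The language

* `encodingDigraphFin n`, `encodingDigraph` — digraphs on `Fin n` as Boolean adjacency matrices
  `Fin n → Fin n → Bool` (loops allowed, no symmetry), coded as `boolPair (encodeNat n) (row-major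
  n·n bits)` exactly like `encodingNatMatrix` of `GraphEncodings.lean`; EVERY bit string of
  length `n²` is a code (`encodingDigraphFin_encode_matrixOfBits`);
* `dhamCircuitSet`, `DHAMCIRCUIT` — yes-instances: a nonempty cyclic listing of all vertices along
  arcs (`IsHamCycleListing`, `Combinatorics/SimpleGraph/HamiltonianCycleListings.lean`; for one
  vertex this is a loop, for two vertices a 2-cycle, the digraph on `Fin 0` is a no-instance);
* `encodingGraphFin_encode_eq_ofFn` — the adjacency-bit description of codes of `HAMCIRCUIT`
  instances; `encode_mem_HAMCIRCUIT_iff`, `encode_mem_DHAMCIRCUIT_iff`, and the fixed non-member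
  `emptyGraphCode`.

## Part 2. `DIRECTED HAMILTON CIRCUIT ≤ₚ HAMILTON CIRCUIT` (Karp 1972): the machine

Karp 1972, Main Theorem: `DIRECTED HAMILTON CIRCUIT ∝ HAMILTON CIRCUIT`; the construction, as
printed by Sipser (Thm. 7.55), replaces each node `u` by `u_in, u_mid, u_out` (`splitGraph`,
`HamiltonianCycleListings.lean`, where its correctness `isHamiltonian_splitGraph_iff` is proved).
Part 2 computes the construction ON CODES in polynomial time and assembles the Karp reduction
**`DHAMCIRCUIT_karpReducible_HAMCIRCUIT : DHAMCIRCUIT ≤ₚ HAMCIRCUIT`**, entirely in the tree's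
algebra of `FP` string functions (no machine is programmed):

* input `w = ⟨bin n, s⟩` with `|s| = n²` (a digraph code); the test `DHamRed.guardFn` (well-formed
  pair ∧ canonical numeral ∧ `|s| = n²`, the size `n` obtained in unary by the bounded conversion
  `binToUnaryFn`) recognises exactly the codes (`DHamRed.isCode_iff`);
* output `⟨bin 3n, bits⟩` where bit `J + 3n·I` (`I, J < 3n`) is the adjacency bit of the vertices
  `(I / 3, I mod 3)` and `(J / 3, J mod 3)` of the split graph (`DHamRed.adjZ`, a one-bit function
  of the record `⟨w, 1ᴷ⟩`, `K = J + 3n I`, built from `divModFn`, `umulFn`, `bitAtFn` and unary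
  comparisons; tabulated by the concatenation fold `Brick.foldLoop appF`), i.e. the code
  (`encodingGraph`) of the split graph transported to `Fin (n * 3)` along `finProdFinEquiv`
  (`DHamRed.splitGraphFin`, `DHamRed.reduceFn_encode`); non-codes are sent to `emptyGraphCode`.

## References

* R. M. Karp, *Reducibility among combinatorial problems*, in: Complexity of Computer
  Computations (R. E. Miller, J. W. Thatcher, eds.), Plenum 1972, 85–103, §4, Main Theorem,
  problems 9 (DIRECTED HAMILTON CIRCUIT) and 10 (HAMILTON CIRCUIT), and the reduction
  DIRECTED HAMILTON CIRCUIT ∝ HAMILTON CIRCUIT.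
* M. Sipser, *Introduction to the Theory of Computation*, 3rd ed., Cengage 2012, Thm. 7.55.
* S. Arora, B. Barak, *Computational Complexity: A Modern Approach*, CUP 2009, §0.1 (adjacency
  matrices as strings), §1.3 (polynomial time is closed under composition and bounded loops),
  Thm. 2.17 (`dHAMPATH`), Ex. 2.18 (`HAMCYCLE`).
-/

/-! ## Part 1. The language DIRECTED HAMILTON CIRCUIT -/


noncomputable section

namespace Literature.Computability.Complexity

open _root_.Computability Literature.Combinatorics.SimpleGraph

/-! ### Digraph codes -/

/-- Digraphs on `Fin n` (fixed `n`) over `Bool`: the Boolean adjacency matrix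
`A : Fin n → Fin n → Bool` (`A u v = true` iff there is an arc `u → v`; loops allowed) as the
row-major bit vector of length `n * n` (`encodingBitVec`, transported along currying and
`finProdFinEquiv`, as `encodingNatMatrixFin`). [cite: Karp1972, §4 Main Theorem problem 9]
[cite: AroraBarakCC2009, §0.1] -/
def encodingDigraphFin (n : ℕ) : Encoding (Fin n → Fin n → Bool) Bool :=
  (encodingBitVec (n * n)).ofEquiv
    ((Equiv.curry (Fin n) (Fin n) Bool).symm.trans (finProdFinEquiv.arrowCongr (Equiv.refl Bool)))

/-- Digraphs `⟨n, A⟩` over `Bool`: `boolPair (encodeNat n) (row-major adjacency bits)`, i.e.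
`sigmaBool encodingDigraphFin`. [cite: Karp1972, §4 Main Theorem problem 9] -/
def encodingDigraph : Encoding (Σ n, Fin n → Fin n → Bool) Bool :=
  Encoding.sigmaBool encodingDigraphFin

/-- Unfolding lemma: the code of `⟨n, A⟩`. [folklore] -/
theorem encodingDigraph_encode (p : Σ n, Fin n → Fin n → Bool) :
    encodingDigraph.encode p = boolPair (encodeNat p.1) ((encodingDigraphFin p.1).encode p.2) := rfl

/-- The adjacency bits of `A`: bit `finProdFinEquiv (u, v) = v + n u` is `A u v`. [folklore] -/
theorem encodingDigraphFin_encode (n : ℕ) (A : Fin n → Fin n → Bool) :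
    (encodingDigraphFin n).encode A =
      List.ofFn fun k : Fin (n * n) => A (finProdFinEquiv.symm k).1 (finProdFinEquiv.symm k).2 := rfl

/-- The length of the adjacency bits is `n * n`. [folklore] -/
@[simp] theorem length_encodingDigraphFin_encode (n : ℕ) (A : Fin n → Fin n → Bool) :
    ((encodingDigraphFin n).encode A).length = n * n := by
  rw [encodingDigraphFin_encode, List.length_ofFn]

/-- The digraph described by a bit string of length `n * n` (row-major). [folklore] -/
def matrixOfBits (n : ℕ) (s : List Bool) (hs : s.length = n * n) : Fin n → Fin n → Bool :=
  fun u v => s[(finProdFinEquiv (u, v) : ℕ)]'(by rw [hs]; exact (finProdFinEquiv (u, v)).2)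

/-- Entry `(u, v)` of `matrixOfBits` is bit `v + n u`. [folklore] -/
theorem matrixOfBits_apply (n : ℕ) (s : List Bool) (hs : s.length = n * n) (u v : Fin n) :
    matrixOfBits n s hs u v = s[(v : ℕ) + n * u]'(by
      rw [hs]; have := (finProdFinEquiv (u, v)).2; simpa using this) := by
  simp [matrixOfBits]

/-- **Every bit string of length `n²` is a digraph code**: it is the code of `matrixOfBits`.
[folklore] -/
theorem encodingDigraphFin_encode_matrixOfBits (n : ℕ) (s : List Bool) (hs : s.length = n * n) :
    (encodingDigraphFin n).encode (matrixOfBits n s hs) = s := by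
  rw [encodingDigraphFin_encode]
  apply List.ext_getElem
  · rw [List.length_ofFn, hs]
  · intro k h1 h2
    rw [List.getElem_ofFn]
    have hk : k % n + n * (k / n) = k := Nat.mod_add_div k n
    simp [matrixOfBits, hk]

/-- **Reading an arc off the code**: bit `v + n u` of the adjacency bits is `A u v`. [folklore] -/
theorem getElem_encodingDigraphFin_encode (n : ℕ) (A : Fin n → Fin n → Bool) (u v : Fin n)
    (h : (v : ℕ) + n * u < ((encodingDigraphFin n).encode A).length) :
    ((encodingDigraphFin n).encode A)[(v : ℕ) + n * u] = A u v := by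
  have hs := length_encodingDigraphFin_encode n A
  rw [← matrixOfBits_apply n _ hs u v,
    (encodingDigraphFin n).encode_injective (encodingDigraphFin_encode_matrixOfBits n _ hs)]

/-! ### DIRECTED HAMILTON CIRCUIT -/

/-- **Yes-instances of DIRECTED HAMILTON CIRCUIT**: digraphs `⟨n, A⟩` with "a directed cycle which
includes each node exactly once", i.e. a nonempty duplicate-free list `l` of all of `Fin n` with
an arc from each entry to the cyclically next one (`IsHamCycleListing`). For `n = 1` this asks
for a loop, for `n = 2` for a 2-cycle; `n = 0` is a no-instance. [cite: Karp1972, §4 Main Theorem problem 9] -/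
def dhamCircuitSet : Set (Σ n, Fin n → Fin n → Bool) :=
  {G | ∃ l : List (Fin G.1), l ≠ [] ∧ IsHamCycleListing (fun u v => G.2 u v = true) l}

/-- Unfolding lemma for `dhamCircuitSet`. [cite: Karp1972, §4 Main Theorem problem 9] -/
theorem mem_dhamCircuitSet_iff (G : Σ n, Fin n → Fin n → Bool) :
    G ∈ dhamCircuitSet ↔
      ∃ l : List (Fin G.1), l ≠ [] ∧ IsHamCycleListing (fun u v => G.2 u v = true) l :=
  Iff.rfl

/-- **The language DIRECTED HAMILTON CIRCUIT** over `{0,1}`: the codes (`encodingDigraph`) of the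
members of `dhamCircuitSet`. [cite: Karp1972, §4 Main Theorem problem 9] -/
def DHAMCIRCUIT : Language Bool :=
  encodingDigraph.toLanguage dhamCircuitSet

/-- Membership of a code in `DHAMCIRCUIT`. [cite: Karp1972, §4 Main Theorem problem 9] -/
theorem encode_mem_DHAMCIRCUIT_iff (G : Σ n, Fin n → Fin n → Bool) :
    encodingDigraph.encode G ∈ DHAMCIRCUIT ↔ G ∈ dhamCircuitSet :=
  encodingDigraph.mem_toLanguage_iff _ _

/-- A member of `DHAMCIRCUIT` is a code. [folklore] -/
theorem exists_eq_encode_of_mem_DHAMCIRCUIT {x : List Bool} (hx : x ∈ DHAMCIRCUIT) :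
    ∃ G ∈ dhamCircuitSet, encodingDigraph.encode G = x := hx

/-! ### Codes of HAMILTON CIRCUIT instances -/

/-- The adjacency bits of a simple graph on `Fin n`: bit `v + n u` is `[G.Adj u v]`.
[cite: AroraBarakCC2009, §0.1] -/
theorem encodingGraphFin_encode_eq_ofFn (n : ℕ) (G : SimpleGraph (Fin n)) [DecidableRel G.Adj] :
    (encodingGraphFin n).encode G =
      List.ofFn fun k : Fin (n * n) =>
        decide (G.Adj (finProdFinEquiv.symm k).1 (finProdFinEquiv.symm k).2) := by
  unfold encodingGraphFin
  simp only [encodingBitVec]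
  congr 1
  funext k
  congr 1

/-- Membership of a code in `HAMCIRCUIT`. [cite: Karp1972, §4 Main Theorem problem 10] -/
theorem encode_mem_HAMCIRCUIT_iff (G : Σ n, SimpleGraph (Fin n)) :
    encodingGraph.encode G ∈ HAMCIRCUIT ↔ G.2.IsHamiltonian :=
  encodingGraph.mem_toLanguage_iff _ _

/-- The code of the graph on no vertices, a fixed non-member of `HAMCIRCUIT` (Mathlib: the empty
graph is not Hamiltonian). [folklore] -/
def emptyGraphCode : List Bool := encodingGraph.encode ⟨0, ⊥⟩

/-- `emptyGraphCode = ⟨ε, ε⟩`. [folklore] -/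
theorem emptyGraphCode_eq : emptyGraphCode = boolPair [] [] := by
  rw [emptyGraphCode, encodingGraph_encode]
  rfl

/-- `emptyGraphCode ∉ HAMCIRCUIT`. [folklore] -/
theorem emptyGraphCode_not_mem_HAMCIRCUIT : emptyGraphCode ∉ HAMCIRCUIT := by
  rintro ⟨⟨n, G⟩, hG, he⟩
  have h := encodingGraph.encode_injective he
  -- `⟨n, G⟩ = ⟨0, ⊥⟩`
  have hn : n = 0 := congrArg Sigma.fst h
  subst hn
  exact SimpleGraph.not_isHamiltonian_of_isEmpty hG

end Literature.Computability.Complexity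

end

/-! ## Part 2. The reduction to HAMILTON CIRCUIT -/


noncomputable section

namespace Literature.Computability.Complexity

open _root_.Computability Polynomial Brick HashBricks Plumb OracleCompose
open Literature.Combinatorics.SimpleGraph
open scoped Notation

namespace DHamRed

/-! ### The size of the input digraph, in unary -/

/-- The number of vertices the input `w = ⟨a, s⟩` denotes: `min ⟦a⟧ |w|` (the cap makes the
unary numeral short; on codes it is not active, `nOf_encode`). [folklore] -/
def nOf (w : List Bool) : ℕ := min (bitsToNat (fstF w)) w.length

/-- `nOf w ≤ |w|`. [folklore] -/
theorem nOf_le (w : List Bool) : nOf w ≤ w.length := min_le_right _ _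

/-- **The unary size** `uF w = 1^{nOf w}` (bounded binary-to-unary conversion of the first field,
ruler the whole input). [cite: AroraBarakCC2009, §1.3] -/
def uF : List Bool → List Bool := binToUnaryFn ∘ fanoutFn id fstF

/-- Value of `uF`. [folklore] -/
@[simp] theorem uF_apply (w : List Bool) : uF w = ones (nOf w) := by
  simp [uF, nOf, ones]

/-- `uF ∈ FP`. [cite: AroraBarakCC2009, §1.3] -/
theorem uF_mem_FP : uF ∈ FP :=
  comp_mem_FP binToUnaryFn_mem_FP (fanoutFn_mem_FP id_mem_FP fstF_mem_FP)

/-- **Thrice the unary size** `mF w = 1^{3 nOf w}` (written `nOf w * 3`) (the number of vertices of the split graph).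
[folklore] -/
def mF : List Bool → List Bool := appF ∘ fanoutFn uF (appF ∘ fanoutFn uF uF)

/-- Value of `mF`. [folklore] -/
@[simp] theorem mF_apply (w : List Bool) : mF w = ones (nOf w * 3) := by
  rw [show nOf w * 3 = nOf w + (nOf w + nOf w) by ring]
  simp [mF, ones]

/-- `mF ∈ FP`. [folklore] -/
theorem mF_mem_FP : mF ∈ FP :=
  comp_mem_FP appF_mem_FP (fanoutFn_mem_FP uF_mem_FP (comp_mem_FP appF_mem_FP (fanoutFn_mem_FP uF_mem_FP uF_mem_FP)))

/-! ### The code test -/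

/-- `w` is a digraph code, arithmetised: `w` is the pair of its two fields, the first field is a
canonical numeral, and the second has length `(nOf w)²`. [folklore] -/
def IsCode (w : List Bool) : Prop :=
  boolPair (fstF w) (sndF w) = w ∧ canonF (fstF w) = fstF w ∧ (sndF w).length = nOf w * nOf w

/-- `IsCode` is decidable (a conjunction of equalities of strings and numbers). [folklore] -/
instance : DecidablePred IsCode := fun _ => inferInstanceAs (Decidable (_ ∧ _ ∧ _))

/-- Test 1: `w = ⟨fst w, snd w⟩`. [folklore] -/
def g1F : List Bool → List Bool := eqPairFn ∘ fanoutFn (fanoutFn fstF sndF) id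

/-- Test 2: the first field is a canonical numeral. [folklore] -/
def g2F : List Bool → List Bool := eqPairFn ∘ fanoutFn (canonF ∘ fstF) fstF

/-- Test 3: `|snd w| = (nOf w)²` (compared in unary). [folklore] -/
def g3F : List Bool → List Bool := eqPairFn ∘ fanoutFn (onesFn ∘ sndF) (umulFn ∘ fanoutFn uF uF)

/-- **The code test** `guardFn = g1 ∧ g2 ∧ g3`. [cite: AroraBarakCC2009, §1.3] -/
def guardFn : List Bool → List Bool := andFn g1F (andFn g2F g3F)

/-- Value of `g1F`. [folklore] -/
@[simp] theorem g1F_apply (w : List Bool) : g1F w = [decide (boolPair (fstF w) (sndF w) = w)] := by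
  simp [g1F, eqPairFn_boolPair]

/-- Value of `g2F`. [folklore] -/
@[simp] theorem g2F_apply (w : List Bool) : g2F w = [decide (canonF (fstF w) = fstF w)] := by
  simp [g2F, eqPairFn_boolPair]

/-- `onesFn x = 1^{|x|}`. [folklore] -/
theorem onesFn_eq (x : List Bool) : onesFn x = ones x.length := by
  simp [onesFn, ones, unaryEncodeNat_eq_replicate]

/-- Value of `g3F`. [folklore] -/
@[simp] theorem g3F_apply (w : List Bool) : g3F w = [decide ((sndF w).length = nOf w * nOf w)] := by
  simp only [g3F, Function.comp_apply, fanoutFn_apply, eqPairFn_boolPair, onesFn_eq, uF_apply,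
    umulFn_boolPair]
  congr 1
  rw [decide_eq_decide]
  constructor
  · intro h; simpa [ones] using congrArg List.length h
  · intro h; rw [h]

/-- **Value of the code test.** [folklore] -/
theorem guardFn_apply (w : List Bool) : guardFn w = [decide (IsCode w)] := by
  rw [guardFn, andFn_apply (g1F_apply w) (andFn_apply (g2F_apply w) (g3F_apply w))]
  simp only [IsCode, Bool.decide_and]

/-- `guardFn ∈ FP`. [cite: AroraBarakCC2009, §1.3] -/
theorem guardFn_mem_FP : guardFn ∈ FP :=
  andFn_mem_FP (comp_mem_FP eqPairFn_mem_FP (fanoutFn_mem_FP (fanoutFn_mem_FP fstF_mem_FP sndF_mem_FP) id_mem_FP))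
    (andFn_mem_FP (comp_mem_FP eqPairFn_mem_FP (fanoutFn_mem_FP (comp_mem_FP canonF_mem_FP fstF_mem_FP) fstF_mem_FP))
      (comp_mem_FP eqPairFn_mem_FP (fanoutFn_mem_FP (comp_mem_FP onesFn_mem_FP sndF_mem_FP)
        (comp_mem_FP umulFn_mem_FP (fanoutFn_mem_FP uF_mem_FP uF_mem_FP)))))

/-! ### Codes pass the test, and only codes do -/

/-- `⟦bin n⟧ ≤ |code|`: a code is at least as long as the number of vertices it announces
(`|s| = n² ≥ n`). [folklore] -/
theorem le_length_encode (n : ℕ) (A : Fin n → Fin n → Bool) :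
    n ≤ (encodingDigraph.encode ⟨n, A⟩).length := by
  rw [encodingDigraph_encode, length_boolPair, length_encodingDigraphFin_encode]
  nlinarith

/-- On a code, `nOf` is the number of vertices. [folklore] -/
theorem nOf_encode (n : ℕ) (A : Fin n → Fin n → Bool) : nOf (encodingDigraph.encode ⟨n, A⟩) = n := by
  have h := le_length_encode n A
  rw [nOf, encodingDigraph_encode, fstF_boolPair, bitsToNat_encodeNat] at *
  exact min_eq_left h

/-- The canonical numeral is fixed by `canonF`. [folklore] -/
theorem canonF_encodeNat (n : ℕ) : canonF (encodeNat n) = encodeNat n := by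
  rw [canonF_eq_encodeNat_decodeNat, decode_encodeNat]

/-- **Codes pass the test.** [folklore] -/
theorem isCode_encode (n : ℕ) (A : Fin n → Fin n → Bool) : IsCode (encodingDigraph.encode ⟨n, A⟩) := by
  refine ⟨?_, ?_, ?_⟩
  · rw [encodingDigraph_encode, fstF_boolPair, sndF_boolPair]
  · rw [encodingDigraph_encode, fstF_boolPair, canonF_encodeNat]
  · rw [nOf_encode, encodingDigraph_encode, sndF_boolPair, length_encodingDigraphFin_encode]

/-- **Only codes pass the test**: a string passing it is the code of the digraph `matrixOfBits` on
`nOf w` vertices read off its second field. [folklore] -/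
theorem eq_encode_of_isCode {w : List Bool} (h : IsCode w) :
    w = encodingDigraph.encode ⟨nOf w, matrixOfBits (nOf w) (sndF w) h.2.2⟩ := by
  obtain ⟨h1, h2, h3⟩ := h
  -- the cap in `nOf` is not active
  have hlen : w.length = 2 * (fstF w).length + 2 + (sndF w).length := by
    conv_lhs => rw [← h1]
    rw [length_boolPair]
  have hn : nOf w = bitsToNat (fstF w) := by
    rw [nOf]
    rcases le_or_gt (bitsToNat (fstF w)) w.length with hle | hlt
    · exact min_eq_left hle
    · exfalso
      have hmin : min (bitsToNat (fstF w)) w.length = w.length := min_eq_right hlt.le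
      rw [nOf, hmin] at h3
      -- `|snd w| = |w|²` but `|snd w| < |w|`
      have hlt' : (sndF w).length < w.length := by rw [hlen]; omega
      rw [h3] at hlt'
      have h0 : 1 ≤ w.length := by rw [hlen]; omega
      nlinarith
  have hfst : fstF w = encodeNat (nOf w) := by
    have e1 : bitsToNat (fstF w) = decodeNat (fstF w) := by
      conv_lhs => rw [← h2]
      exact bitsToNat_canonF _
    rw [hn, e1, ← canonF_eq_encodeNat_decodeNat, h2]
  rw [encodingDigraph_encode]
  dsimp only
  rw [encodingDigraphFin_encode_matrixOfBits, ← hfst]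
  exact h1.symm

/-- The code test recognises exactly the codes. [folklore] -/
theorem isCode_iff (w : List Bool) : IsCode w ↔ ∃ G : Σ n, Fin n → Fin n → Bool, encodingDigraph.encode G = w :=
  ⟨fun h => ⟨_, (eq_encode_of_isCode h).symm⟩, by rintro ⟨⟨n, A⟩, rfl⟩; exact isCode_encode n A⟩

/-! ### The adjacency bit of the split graph at a flat index -/

/-- The arcs of `A` read on numerical vertex indices (`false` out of range). [folklore] -/
def arcOf {n : ℕ} (A : Fin n → Fin n → Bool) (v x : ℕ) : Bool :=
  if h : v < n ∧ x < n then A ⟨v, h.1⟩ ⟨x, h.2⟩ else false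

/-- In range, `arcOf` reads the matrix. [folklore] -/
theorem arcOf_eq {n : ℕ} (A : Fin n → Fin n → Bool) {v x : ℕ} (hv : v < n) (hx : x < n) :
    arcOf A v x = A ⟨v, hv⟩ ⟨x, hx⟩ := by
  simp [arcOf, hv, hx]

/-- The tag test `[σ = a ∧ τ = b]` as a Boolean. [folklore] -/
def tagB (σ τ a b : ℕ) : Bool := decide (σ = a) && decide (τ = b)

/-- **The adjacency predicate of the split graph, on numerical vertex data**: vertices `(v, σ)`
and `(x, τ)` (`σ, τ ∈ {0,1,2}` the in/mid/out tags), arcs read by `arc`; written with the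
association produced by the bricks below. [cite: Sipser2012, Thm. 7.55 (construction)] -/
def splitAdjB (arc : ℕ → ℕ → Bool) (v σ x τ : ℕ) : Bool :=
  (decide (v = x) && (tagB σ τ 0 1 || (tagB σ τ 1 2 || (tagB σ τ 1 0 || tagB σ τ 2 1)))) ||
    (tagB σ τ 2 0 && arc v x || tagB σ τ 0 2 && arc x v)

/-- **`splitAdjB` computes adjacency in the split graph.** [cite: Sipser2012, Thm. 7.55 (construction)] -/
theorem splitAdjB_eq_true_iff {n : ℕ} (A : Fin n → Fin n → Bool) {v σ x τ : ℕ} (hv : v < n)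
    (hσ : σ < 3) (hx : x < n) (hτ : τ < 3) :
    splitAdjB (arcOf A) v σ x τ = true ↔
      (splitGraph fun u w => A u w = true).Adj ((⟨v, hv⟩ : Fin n), (⟨σ, hσ⟩ : Fin 3))
        (⟨x, hx⟩, ⟨τ, hτ⟩) := by
  rw [splitGraph_adj_iff]
  simp only [splitAdjB, tagB, splitRel, arcOf_eq A hv hx, arcOf_eq A hx hv, ne_eq, Prod.mk.injEq,
    Fin.ext_iff, Fin.val_zero, Fin.val_one, Fin.val_two, Bool.or_eq_true, Bool.and_eq_true,
    decide_eq_true_eq]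
  generalize A ⟨v, hv⟩ ⟨x, hx⟩ = p
  generalize A ⟨x, hx⟩ ⟨v, hv⟩ = q
  cases p <;> cases q <;> simp <;> omega

section Record

/-! Bricks on the record `z = ⟨w, 1ᴷ⟩` (`w` the input, `K` the flat output index). -/

/-- `1ⁿ` from the record. [folklore] -/
def uZ : List Bool → List Bool := uF ∘ fstF
/-- `1^{3n}` from the record. [folklore] -/
def mZ : List Bool → List Bool := mF ∘ fstF
/-- `⟨1^I, 1^J⟩ = ⟨1^{K / 3n}, 1^{K mod 3n}⟩`. [folklore] -/
def ijZ : List Bool → List Bool := divModFn ∘ fanoutFn mZ sndF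
/-- `⟨1^{I/3}, 1^{I mod 3}⟩`. [folklore] -/
def vsZ : List Bool → List Bool := divModFn ∘ fanoutFn (fun _ => ones 3) (fstF ∘ ijZ)
/-- `⟨1^{J/3}, 1^{J mod 3}⟩`. [folklore] -/
def xtZ : List Bool → List Bool := divModFn ∘ fanoutFn (fun _ => ones 3) (sndF ∘ ijZ)
/-- `1^v`, `v = I / 3`. [folklore] -/
def vZ : List Bool → List Bool := fstF ∘ vsZ
/-- `1^σ`, `σ = I mod 3`. [folklore] -/
def sgZ : List Bool → List Bool := sndF ∘ vsZ
/-- `1^x`, `x = J / 3`. [folklore] -/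
def xZ : List Bool → List Bool := fstF ∘ xtZ
/-- `1^τ`, `τ = J mod 3`. [folklore] -/
def tuZ : List Bool → List Bool := sndF ∘ xtZ
/-- The bit block `s` of the input. [folklore] -/
def sZ : List Bool → List Bool := sndF ∘ fstF
/-- The arc bit `s[x + n v]` (arc `v → x`), forced to one bit. [folklore] -/
def arc1Z : List Bool → List Bool :=
  headBitFn ∘ bitAtFn ∘ fanoutFn (appF ∘ fanoutFn xZ (umulFn ∘ fanoutFn uZ vZ)) sZ
/-- The arc bit `s[v + n x]` (arc `x → v`), forced to one bit. [folklore] -/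
def arc2Z : List Bool → List Bool :=
  headBitFn ∘ bitAtFn ∘ fanoutFn (appF ∘ fanoutFn vZ (umulFn ∘ fanoutFn uZ xZ)) sZ
/-- Equality test of two (unary) fields. [folklore] -/
def eqZ (f g : List Bool → List Bool) : List Bool → List Bool := eqPairFn ∘ fanoutFn f g
/-- The tag test `[σ = a ∧ τ = b]`. [folklore] -/
def tagZ (a b : ℕ) : List Bool → List Bool := andFn (eqZ sgZ fun _ => ones a) (eqZ tuZ fun _ => ones b)
/-- The "same vertex" part of the adjacency bit. [folklore] -/
def sameZ : List Bool → List Bool :=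
  andFn (eqZ vZ xZ) (orFn (tagZ 0 1) (orFn (tagZ 1 2) (orFn (tagZ 1 0) (tagZ 2 1))))

/-- **The adjacency bit** of the output at the flat index of the record (the Boolean formula
`splitAdjB` on the bricks above). [cite: Sipser2012, Thm. 7.55 (construction)] -/
def adjZ : List Bool → List Bool :=
  orFn sameZ (orFn (andFn (tagZ 2 0) arc1Z) (andFn (tagZ 0 2) arc2Z))

/-! #### Membership in `FP` and one-bit outputs -/

/-- `uZ ∈ FP`. [cite: AroraBarakCC2009, §1.3] -/
theorem uZ_mem_FP : uZ ∈ FP := comp_mem_FP uF_mem_FP fstF_mem_FP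
/-- `mZ ∈ FP`. [cite: AroraBarakCC2009, §1.3] -/
theorem mZ_mem_FP : mZ ∈ FP := comp_mem_FP mF_mem_FP fstF_mem_FP
/-- `ijZ ∈ FP`. [cite: AroraBarakCC2009, §1.3] -/
theorem ijZ_mem_FP : ijZ ∈ FP := comp_mem_FP divModFn_mem_FP (fanoutFn_mem_FP mZ_mem_FP sndF_mem_FP)
/-- `vsZ ∈ FP`. [cite: AroraBarakCC2009, §1.3] -/
theorem vsZ_mem_FP : vsZ ∈ FP :=
  comp_mem_FP divModFn_mem_FP (fanoutFn_mem_FP (const_mem_FP _) (comp_mem_FP fstF_mem_FP ijZ_mem_FP))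
/-- `xtZ ∈ FP`. [cite: AroraBarakCC2009, §1.3] -/
theorem xtZ_mem_FP : xtZ ∈ FP :=
  comp_mem_FP divModFn_mem_FP (fanoutFn_mem_FP (const_mem_FP _) (comp_mem_FP sndF_mem_FP ijZ_mem_FP))
/-- `vZ ∈ FP`. [cite: AroraBarakCC2009, §1.3] -/
theorem vZ_mem_FP : vZ ∈ FP := comp_mem_FP fstF_mem_FP vsZ_mem_FP
/-- `sgZ ∈ FP`. [cite: AroraBarakCC2009, §1.3] -/
theorem sgZ_mem_FP : sgZ ∈ FP := comp_mem_FP sndF_mem_FP vsZ_mem_FP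
/-- `xZ ∈ FP`. [cite: AroraBarakCC2009, §1.3] -/
theorem xZ_mem_FP : xZ ∈ FP := comp_mem_FP fstF_mem_FP xtZ_mem_FP
/-- `tuZ ∈ FP`. [cite: AroraBarakCC2009, §1.3] -/
theorem tuZ_mem_FP : tuZ ∈ FP := comp_mem_FP sndF_mem_FP xtZ_mem_FP
/-- `sZ ∈ FP`. [cite: AroraBarakCC2009, §1.3] -/
theorem sZ_mem_FP : sZ ∈ FP := comp_mem_FP sndF_mem_FP fstF_mem_FP
/-- `arc1Z ∈ FP`. [cite: AroraBarakCC2009, §1.3] -/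
theorem arc1Z_mem_FP : arc1Z ∈ FP :=
  comp_mem_FP headBitFn_mem_FP (comp_mem_FP bitAtFn_mem_FP (fanoutFn_mem_FP
    (comp_mem_FP appF_mem_FP (fanoutFn_mem_FP xZ_mem_FP (comp_mem_FP umulFn_mem_FP (fanoutFn_mem_FP uZ_mem_FP vZ_mem_FP))))
    sZ_mem_FP))
/-- `arc2Z ∈ FP`. [cite: AroraBarakCC2009, §1.3] -/
theorem arc2Z_mem_FP : arc2Z ∈ FP :=
  comp_mem_FP headBitFn_mem_FP (comp_mem_FP bitAtFn_mem_FP (fanoutFn_mem_FP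
    (comp_mem_FP appF_mem_FP (fanoutFn_mem_FP vZ_mem_FP (comp_mem_FP umulFn_mem_FP (fanoutFn_mem_FP uZ_mem_FP xZ_mem_FP))))
    sZ_mem_FP))
/-- `eqZ ∈ FP`. [cite: AroraBarakCC2009, §1.3] -/
theorem eqZ_mem_FP {f g : List Bool → List Bool} (hf : f ∈ FP) (hg : g ∈ FP) : eqZ f g ∈ FP :=
  comp_mem_FP eqPairFn_mem_FP (fanoutFn_mem_FP hf hg)
/-- `tagZ ∈ FP`. [cite: AroraBarakCC2009, §1.3] -/
theorem tagZ_mem_FP (a b : ℕ) : tagZ a b ∈ FP :=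
  andFn_mem_FP (eqZ_mem_FP sgZ_mem_FP (const_mem_FP _)) (eqZ_mem_FP tuZ_mem_FP (const_mem_FP _))
/-- `sameZ ∈ FP`. [cite: AroraBarakCC2009, §1.3] -/
theorem sameZ_mem_FP : sameZ ∈ FP :=
  andFn_mem_FP (eqZ_mem_FP vZ_mem_FP xZ_mem_FP) (orFn_mem_FP (tagZ_mem_FP 0 1)
    (orFn_mem_FP (tagZ_mem_FP 1 2) (orFn_mem_FP (tagZ_mem_FP 1 0) (tagZ_mem_FP 2 1))))

/-- **`adjZ ∈ FP`.** [cite: AroraBarakCC2009, §1.3] -/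
theorem adjZ_mem_FP : adjZ ∈ FP :=
  orFn_mem_FP sameZ_mem_FP (orFn_mem_FP (andFn_mem_FP (tagZ_mem_FP 2 0) arc1Z_mem_FP)
    (andFn_mem_FP (tagZ_mem_FP 0 2) arc2Z_mem_FP))

/-- `eqZ f g` is one-bit. [folklore] -/
theorem oneBit_eqZ (f g : List Bool → List Bool) : OneBit (eqZ f g) := fun z =>
  ⟨_, by rw [eqZ, Function.comp_apply, fanoutFn_apply, eqPairFn_boolPair]⟩

/-- `tagZ` is one-bit. [folklore] -/
theorem oneBit_tagZ (a b : ℕ) : OneBit (tagZ a b) := oneBit_andFn (oneBit_eqZ _ _) (oneBit_eqZ _ _)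

/-- `sameZ` is one-bit. [folklore] -/
theorem oneBit_sameZ : OneBit sameZ :=
  oneBit_andFn (oneBit_eqZ _ _) (oneBit_orFn (oneBit_tagZ 0 1) (oneBit_orFn (oneBit_tagZ 1 2)
    (oneBit_orFn (oneBit_tagZ 1 0) (oneBit_tagZ 2 1))))

/-- **`adjZ` is one-bit.** [folklore] -/
theorem oneBit_adjZ : OneBit adjZ :=
  oneBit_orFn oneBit_sameZ (oneBit_orFn (oneBit_andFn (oneBit_tagZ 2 0) (oneBit_headBitFn.comp _))
    (oneBit_andFn (oneBit_tagZ 0 2) (oneBit_headBitFn.comp _)))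

/-! #### Values on a record `⟨w, 1ᴷ⟩` -/

variable (w : List Bool) (K : ℕ)

/-- Value of `uZ` on a record `⟨w, 1ᴷ⟩`. [folklore] -/
@[simp] theorem uZ_rec : uZ (boolPair w (ones K)) = ones (nOf w) := by simp [uZ]
/-- Value of `mZ` on a record `⟨w, 1ᴷ⟩`. [folklore] -/
@[simp] theorem mZ_rec : mZ (boolPair w (ones K)) = ones (nOf w * 3) := by simp [mZ]
/-- Value of `ijZ` on a record `⟨w, 1ᴷ⟩`. [folklore] -/
@[simp] theorem ijZ_rec : ijZ (boolPair w (ones K)) =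
    boolPair (ones (K / (nOf w * 3))) (ones (K % (nOf w * 3))) := by
  simp [ijZ]
/-- Value of `vZ` on a record `⟨w, 1ᴷ⟩`. [folklore] -/
@[simp] theorem vZ_rec : vZ (boolPair w (ones K)) = ones (K / (nOf w * 3) / 3) := by simp [vZ, vsZ]
/-- Value of `sgZ` on a record `⟨w, 1ᴷ⟩`. [folklore] -/
@[simp] theorem sgZ_rec : sgZ (boolPair w (ones K)) = ones (K / (nOf w * 3) % 3) := by simp [sgZ, vsZ]
/-- Value of `xZ` on a record `⟨w, 1ᴷ⟩`. [folklore] -/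
@[simp] theorem xZ_rec : xZ (boolPair w (ones K)) = ones (K % (nOf w * 3) / 3) := by simp [xZ, xtZ]
/-- Value of `tuZ` on a record `⟨w, 1ᴷ⟩`. [folklore] -/
@[simp] theorem tuZ_rec : tuZ (boolPair w (ones K)) = ones (K % (nOf w * 3) % 3) := by simp [tuZ, xtZ]
/-- Value of `sZ` on a record `⟨w, 1ᴷ⟩`. [folklore] -/
@[simp] theorem sZ_rec : sZ (boolPair w (ones K)) = sndF w := by simp [sZ]

/-- Equality of unary numerals is equality of the numbers. [folklore] -/
theorem ones_inj_iff (a b : ℕ) : ones a = ones b ↔ a = b :=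
  ⟨fun h => by simpa [ones] using congrArg List.length h, fun h => by rw [h]⟩

/-- Value of an equality test of two unary fields on a record. [folklore] -/
theorem eqZ_rec_of {f g : List Bool → List Bool} {a b : ℕ} (hf : f (boolPair w (ones K)) = ones a)
    (hg : g (boolPair w (ones K)) = ones b) : eqZ f g (boolPair w (ones K)) = [decide (a = b)] := by
  rw [eqZ, Function.comp_apply, fanoutFn_apply, hf, hg, eqPairFn_boolPair]
  simp only [ones_inj_iff]

/-- Value of the tag test on a record. [folklore] -/
theorem tagZ_rec (a b : ℕ) : tagZ a b (boolPair w (ones K)) =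
    [tagB (K / (nOf w * 3) % 3) (K % (nOf w * 3) % 3) a b] :=
  andFn_apply (eqZ_rec_of w K (sgZ_rec w K) rfl) (eqZ_rec_of w K (tuZ_rec w K) rfl)

/-- Value of the same-vertex part on a record. [folklore] -/
theorem sameZ_rec : sameZ (boolPair w (ones K)) =
    [decide (K / (nOf w * 3) / 3 = K % (nOf w * 3) / 3) &&
      (tagB (K / (nOf w * 3) % 3) (K % (nOf w * 3) % 3) 0 1 ||
        (tagB (K / (nOf w * 3) % 3) (K % (nOf w * 3) % 3) 1 2 ||
          (tagB (K / (nOf w * 3) % 3) (K % (nOf w * 3) % 3) 1 0 ||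
            tagB (K / (nOf w * 3) % 3) (K % (nOf w * 3) % 3) 2 1)))] :=
  andFn_apply (eqZ_rec_of w K (vZ_rec w K) (xZ_rec w K))
    (orFn_apply (tagZ_rec w K 0 1) (orFn_apply (tagZ_rec w K 1 2)
      (orFn_apply (tagZ_rec w K 1 0) (tagZ_rec w K 2 1))))

variable {w}

/-- The arc entry read at unary position `1^{x + n v}` of the bit block of a code.
[folklore] -/
theorem headBitFn_bitAtFn_eq {n : ℕ} (A : Fin n → Fin n → Bool) {v x : ℕ} (hv : v < n) (hx : x < n) :
    headBitFn (bitAtFn (boolPair (ones (x + n * v)) ((encodingDigraphFin n).encode A))) =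
      [A ⟨v, hv⟩ ⟨x, hx⟩] := by
  have hlt : x + n * v < ((encodingDigraphFin n).encode A).length := by
    rw [length_encodingDigraphFin_encode]; nlinarith
  have hlen : (ones (x + n * v)).length = x + n * v := by simp [ones]
  rw [bitAtFn_boolPair_of_lt _ _ (by rw [hlen]; exact hlt), headBitFn_apply]
  simp only [List.headD_cons, hlen]
  rw [getElem_encodingDigraphFin_encode n A ⟨v, hv⟩ ⟨x, hx⟩]

/-- The indices read off `K < (3n)²` are in range. [folklore] -/
theorem div_three_lt {n K : ℕ} (hK : K < n * 3 * (n * 3)) : K / (n * 3) / 3 < n := by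
  have h1 : K / (n * 3) < n * 3 := Nat.div_lt_of_lt_mul hK
  omega

/-- The indices read off `K < (3n)²` are in range (column). [folklore] -/
theorem mod_three_lt {n K : ℕ} (hK : K < n * 3 * (n * 3)) : K % (n * 3) / 3 < n := by
  have hn : 0 < n * 3 := Nat.pos_of_ne_zero fun h0 => by simp [h0] at hK
  have h1 : K % (n * 3) < n * 3 := Nat.mod_lt _ hn
  omega

variable (n : ℕ) (A : Fin n → Fin n → Bool) {K}

/-- Value of the first arc bit on a code, at a flat index in range. [folklore] -/
theorem arc1Z_encode (hK : K < n * 3 * (n * 3)) :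
    arc1Z (boolPair (encodingDigraph.encode ⟨n, A⟩) (ones K)) =
      [arcOf A (K / (n * 3) / 3) (K % (n * 3) / 3)] := by
  have hv := div_three_lt hK
  have hx := mod_three_lt hK
  rw [arcOf_eq A hv hx, ← headBitFn_bitAtFn_eq A hv hx]
  simp only [arc1Z, Function.comp_apply, fanoutFn_apply, xZ_rec, uZ_rec, vZ_rec, umulFn_boolPair,
    appF_boolPair, sZ_rec, nOf_encode]
  rw [encodingDigraph_encode, sndF_boolPair]
  simp [ones]

/-- Value of the second arc bit on a code, at a flat index in range. [folklore] -/
theorem arc2Z_encode (hK : K < n * 3 * (n * 3)) :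
    arc2Z (boolPair (encodingDigraph.encode ⟨n, A⟩) (ones K)) =
      [arcOf A (K % (n * 3) / 3) (K / (n * 3) / 3)] := by
  have hv := div_three_lt hK
  have hx := mod_three_lt hK
  rw [arcOf_eq A hx hv, ← headBitFn_bitAtFn_eq A hx hv]
  simp only [arc2Z, Function.comp_apply, fanoutFn_apply, xZ_rec, uZ_rec, vZ_rec, umulFn_boolPair,
    appF_boolPair, sZ_rec, nOf_encode]
  rw [encodingDigraph_encode, sndF_boolPair]
  simp [ones]

/-- **Value of the adjacency bit on a code**, at a flat index `K < (3n)²`.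
[cite: Sipser2012, Thm. 7.55 (construction)] -/
theorem adjZ_encode (hK : K < n * 3 * (n * 3)) :
    adjZ (boolPair (encodingDigraph.encode ⟨n, A⟩) (ones K)) =
      [splitAdjB (arcOf A) (K / (n * 3) / 3) (K / (n * 3) % 3) (K % (n * 3) / 3) (K % (n * 3) % 3)] := by
  have h := orFn_apply (sameZ_rec (encodingDigraph.encode ⟨n, A⟩) K)
    (orFn_apply (andFn_apply (tagZ_rec (encodingDigraph.encode ⟨n, A⟩) K 2 0) (arc1Z_encode n A hK))
      (andFn_apply (tagZ_rec (encodingDigraph.encode ⟨n, A⟩) K 0 2) (arc2Z_encode n A hK)))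
  rw [nOf_encode] at h
  rw [adjZ, h, splitAdjB]

end Record

/-! ### Tabulating the adjacency bits -/

/-- The number of output bits `(3n)²` in binary, from the input. [folklore] -/
def cntF : List Bool → List Bool := lenBinF ∘ umulFn ∘ fanoutFn mF mF

/-- Value of `cntF`. [folklore] -/
@[simp] theorem cntF_apply (w : List Bool) : cntF w = encodeNat (nOf w * 3 * (nOf w * 3)) := by
  simp [cntF, ones]

/-- `cntF ∈ FP`. [cite: AroraBarakCC2009, §1.3] -/
theorem cntF_mem_FP : cntF ∈ FP :=
  comp_mem_FP lenBinF_mem_FP (comp_mem_FP umulFn_mem_FP (fanoutFn_mem_FP mF_mem_FP mF_mem_FP))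

/-- The initial record `⟨w, ⟨bin (3n)², ⟨1⁰, ε⟩⟩⟩` of the tabulation loop. [folklore] -/
def initF : List Bool → List Bool := fanoutFn id (fanoutFn cntF fun _ => boolPair [] [])

/-- `initF ∈ FP`. [cite: AroraBarakCC2009, §1.3] -/
theorem initF_mem_FP : initF ∈ FP :=
  fanoutFn_mem_FP id_mem_FP (fanoutFn_mem_FP cntF_mem_FP (const_mem_FP _))

/-- **The tabulation** of the adjacency bits: the concatenation fold of `adjZ` over the flat
indices `K < (3n)²`. [cite: AroraBarakCC2009, §1.3 (bounded loops)] -/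
def tabF : List Bool → List Bool := sndPow 2 ∘ foldLoop appF adjZ (C 9 * X) ∘ initF

/-- **`tabF ∈ FP`.** [cite: AroraBarakCC2009, §1.3 (bounded loops)] -/
theorem tabF_mem_FP : tabF ∈ FP :=
  comp_mem_FP (sndPow_mem_FP 2) (comp_mem_FP
    (foldLoop_mem_FP appF_mem_FP length_appF_le adjZ_mem_FP (C := 1)
      (fun z => by rw [oneBit_adjZ.length_eq]; omega) (C 9 * X))
    initF_mem_FP)

/-- A concatenation of singletons is a `List.ofFn`. [folklore] -/
theorem ccat_eq_ofFn {g : ℕ → List Bool} {k : ℕ} {b : Fin k → Bool} (h : ∀ (j : ℕ) (hj : j < k), g j = [b ⟨j, hj⟩]) :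
    ccat g k = List.ofFn b := by
  induction k with
  | zero => simp
  | succ k ih =>
    rw [ccat_succ, List.ofFn_succ', ih (b := fun i => b i.castSucc) (fun j hj => h j (by omega)),
      h k (by omega), List.concat_eq_append]
    rfl

/-- **Value of the tabulation on a code**: the list of adjacency bits at the flat indices.
[cite: Sipser2012, Thm. 7.55 (construction)] -/
theorem tabF_encode (n : ℕ) (A : Fin n → Fin n → Bool) :
    tabF (encodingDigraph.encode ⟨n, A⟩) =
      List.ofFn fun k : Fin (n * 3 * (n * 3)) =>
        splitAdjB (arcOf A) (k / (n * 3) / 3) (k / (n * 3) % 3) (k % (n * 3) / 3) (k % (n * 3) % 3) := by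
  set w := encodingDigraph.encode ⟨n, A⟩ with hw
  have hn : nOf w = n := nOf_encode n A
  have hk : n * 3 * (n * 3) ≤ (C 9 * X : ℕ[X]).eval w.length := by
    have : n * n ≤ w.length := by
      rw [hw, encodingDigraph_encode, length_boolPair, length_encodingDigraphFin_encode]
      dsimp only
      omega
    simp only [eval_mul, eval_C, eval_X]
    nlinarith
  have hinit : initF w = boolPair w (boolPair (encodeNat (n * 3 * (n * 3))) (boolPair (ones 0) [])) := by
    simp [initF, hn, ones]
  rw [tabF, Function.comp_apply, Function.comp_apply, hinit, foldLoop_apply appF adjZ hk 0 [],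
    sndPow_succ_boolPair, sndPow_succ_boolPair, sndPow_zero_boolPair, foldAcc_appF, List.nil_append]
  refine ccat_eq_ofFn fun j hj => ?_
  rw [Nat.zero_add, hw, adjZ_encode n A hj]

/-! ### The reduction function -/

/-- The size numeral `bin 3n` of the output. [folklore] -/
def sizeF : List Bool → List Bool := lenBinF ∘ mF

/-- Value of `sizeF`. [folklore] -/
@[simp] theorem sizeF_apply (w : List Bool) : sizeF w = encodeNat (nOf w * 3) := by
  simp [sizeF, ones]

/-- `sizeF ∈ FP`. [cite: AroraBarakCC2009, §1.3] -/
theorem sizeF_mem_FP : sizeF ∈ FP := comp_mem_FP lenBinF_mem_FP mF_mem_FP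

/-- **The reduction**: on a digraph code, the code `⟨bin 3n, adjacency bits⟩` of the split graph;
on any other string, the code of the empty graph. [cite: Karp1972, §4 Main Theorem (problems 9, 10)]
[cite: Sipser2012, Thm. 7.55] -/
def reduceFn : List Bool → List Bool := iteFn guardFn (fanoutFn sizeF tabF) fun _ => emptyGraphCode

/-- **`reduceFn ∈ FP`.** [cite: AroraBarakCC2009, §1.3] -/
theorem reduceFn_mem_FP : reduceFn ∈ FP :=
  iteFn_mem_FP guardFn_mem_FP (fanoutFn_mem_FP sizeF_mem_FP tabF_mem_FP) (const_mem_FP _)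

/-- Value of the reduction on a non-code. [folklore] -/
theorem reduceFn_of_not_isCode {w : List Bool} (h : ¬IsCode w) : reduceFn w = emptyGraphCode := by
  rw [reduceFn, iteFn_apply_false (by rw [guardFn_apply, decide_eq_false h])]

/-- **The split graph on `Fin (n * 3)`**: `splitGraph` of the arc relation of `A`, transported along
`finProdFinEquiv : Fin n × Fin 3 ≃ Fin (n * 3)` (vertex `(v, σ) ↦ σ + 3 v`).
[cite: Sipser2012, Thm. 7.55 (construction)] -/
def splitGraphFin (n : ℕ) (A : Fin n → Fin n → Bool) : SimpleGraph (Fin (n * 3)) :=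
  (splitGraph fun u w => A u w = true).comap finProdFinEquiv.symm

/-- `splitGraphFin` is isomorphic to the split graph. [folklore] -/
def splitGraphFinIso (n : ℕ) (A : Fin n → Fin n → Bool) :
    splitGraphFin n A ≃g splitGraph fun u w => A u w = true :=
  SimpleGraph.Iso.comap finProdFinEquiv.symm _

/-- A Boolean equals `decide P` as soon as it is `true` exactly when `P`. [folklore] -/
theorem bool_eq_decide {P : Prop} [Decidable P] {b : Bool} (h : b = true ↔ P) : b = decide P := by
  cases b
  · symm; rw [decide_eq_false_iff_not]; exact fun hP => Bool.false_ne_true (h.2 hP)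
  · symm; rw [decide_eq_true_iff]; exact h.1 rfl

/-- **Value of the reduction on a code**: the code of `splitGraphFin`.
[cite: Karp1972, §4 Main Theorem (problems 9, 10)] [cite: Sipser2012, Thm. 7.55] -/
theorem reduceFn_encode (n : ℕ) (A : Fin n → Fin n → Bool) :
    reduceFn (encodingDigraph.encode ⟨n, A⟩) = encodingGraph.encode ⟨n * 3, splitGraphFin n A⟩ := by
  classical
  rw [reduceFn, iteFn_apply_true (by rw [guardFn_apply, decide_eq_true (isCode_encode n A)]),
    fanoutFn_apply, sizeF_apply, nOf_encode, tabF_encode, encodingGraph_encode]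
  dsimp only
  rw [encodingGraphFin_encode_eq_ofFn]
  congr 1
  refine congrArg List.ofFn (funext fun k => ?_)
  refine bool_eq_decide ?_
  have hk : (k : ℕ) < n * 3 * (n * 3) := k.2
  rw [splitAdjB_eq_true_iff A (div_three_lt hk) (Nat.mod_lt _ (by norm_num)) (mod_three_lt hk)
    (Nat.mod_lt _ (by norm_num))]
  simp only [splitGraphFin, SimpleGraph.comap_adj, finProdFinEquiv_symm_apply]
  rfl

end DHamRed

/-! ### The Karp reduction -/

open DHamRed in
/-- **Karp 1972: `DIRECTED HAMILTON CIRCUIT ∝ HAMILTON CIRCUIT`** (Main Theorem, problems 9 → 10;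
the construction of Sipser's Thm. 7.55), as a polynomial-time Karp reduction between the tree's
languages `DHAMCIRCUIT` and `HAMCIRCUIT`. [cite: Karp1972, §4 Main Theorem (problems 9, 10)]
[cite: Sipser2012, Thm. 7.55] -/
theorem DHAMCIRCUIT_karpReducible_HAMCIRCUIT : DHAMCIRCUIT ≤ₚ HAMCIRCUIT := by
  refine ⟨reduceFn, reduceFn_mem_FP, fun x => ?_⟩
  show x ∈ DHAMCIRCUIT ↔ reduceFn x ∈ HAMCIRCUIT
  by_cases hx : IsCode x
  · obtain ⟨⟨n, A⟩, rfl⟩ := (isCode_iff x).1 hx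
    rw [reduceFn_encode, encode_mem_DHAMCIRCUIT_iff, encode_mem_HAMCIRCUIT_iff, mem_dhamCircuitSet_iff]
    dsimp only
    rw [isHamiltonian_iff_of_iso (splitGraphFinIso n A), isHamiltonian_splitGraph_iff]
  · rw [reduceFn_of_not_isCode hx]
    constructor
    · rintro ⟨G, -, hG⟩
      exact (hx ((isCode_iff x).2 ⟨G, hG⟩)).elim
    · intro h
      exact (emptyGraphCode_not_mem_HAMCIRCUIT h).elim

end Literature.Computability.Complexity

end
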